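import Summits.CriticalPhenomena.PercolationContinuityZ3.Theorems.PercNearOneGluingNoHeavyLowerTailJointLemma3Sharp
import Summits.CriticalPhenomena.PercolationContinuityZ3.Theorems.PercNearOneGluingNoHeavyLowerTailUpsetExchange
import Summits.CriticalPhenomena.PercolationContinuityZ3.Theorems.PercNearOneGluingAdditiveGluingGluingLemma5
import HarnessLib

/-!
# `NoHeavyLowerTail` (stmt-CriticalPhenomena-4575) — the ANCHORED JOINT up-set exchange: Kozma–Nitzan's
# Lemma 3 (i)+(ii) jointly, with the comparison relay ranked in the UNGLUED graph

Support file (lemma factory `prim-lf-7`, conditional association, gen 10; `--supports stmt-CriticalPhenomena-4575`).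
No definitions, no named facts, no sorries.  Settles conjecture `UEJ` of the factory's batch 15
(`run/shared/lean/prim/prim-lf-7/CANDIDATES.md`; memo `FROM-prim-lf-7-gen9.md` §5, validated 0 / 10⁶ there).

Setting (`Fin n`; `μ_w = prodBernoulli w`; a block `S`; `glue_S w` = every non-loop pair inside `S` given weight `1`,
any internal weights allowed).  The tree has the two halves separately:
* `JointLemma3.lemma3_joint` — UNANCHORED joint Lemma 3: `μ(a₁↔b) ≤ μ(a₂↔b) + δ` ⟹
  `μ(a₁↔b, Q) ≤ μ(a₂↔b, Q) + δ` for every event `Q` increasing in `C_{a₂}` and decreasing in `C_{a₁}`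
  (van den Berg–Häggström–Kahn 2006 Thm. 1.5 twice);
* `UpsetExchange.upsetExchange_event` — ANCHORED up-set exchange: the relay `a` is compared with the anchor `v` in
  the unglued graph `w`, the conclusion holds in `glue_S w` on every event increasing in `C_v` (KN Lemma 5 by
  ε-sprinkling inside the block + Lemma 3(i) in the sharp form `+ d·μ(Q)`).
The obstruction recorded in the gen-9 memo ("the sprinkling proof needs the sharp form `+ d·μ(Q)`, which uses Harris
between `Q` and `D = {a₁ ↮ a₂}` and fails for up/down events") disappears on inspecting the proof of
`lemma3_joint`: BEFORE its last weakening it yields the sharper error `δ·μ(Q ∩ D)/μ(D)` (no Harris needed), and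
under sprinkling `μ_{w_ε}(D ∩ {S internally open}) = μ_{w_ε}(S internally open)·μ_{glue}(D) ≤ μ_{w_ε}(S internally open)·μ_{w_ε}(D)`
because `D = {v ↮ a}` is DECREASING and `w_ε ≤ glue_S w`.  Hence:

* (companion file `…NoHeavyLowerTailJointLemma3Sharp.lean`) `JointLemma3.lemma3_joint_sharp` / `lemma3_joint_event`
  — joint Lemma 3 with the error `δ·μ(Q ∩ D)/μ(D)` (family form / pointwise-monotone event form).
* `UpsetExchange.upsetExchange_joint` — **anchored joint exchange**: if `μ_w(a ↔ b) ≤ μ_w(v ↔ b)` then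
  `μ_{glue_S w}(a ↔ b, E) ≤ μ_{glue_S w}(v ↔ b, E)` for every event `E` such that `E ∩ {S internally open}` is
  increasing in `C_v` and decreasing in `C_a` (any internal weights on `S`; `v`, `a` arbitrary).
* Instances: `upsetExchange_joint_family` (`E = {v ↔ s₀} ∩ {(C_v, C_a) ∈ 𝒬}`, `s₀ ∈ S`, `𝒬` an upper family),
  `upsetExchange_joint_open` (`E = {C open} ∩ {(C_v, C_a) ∈ 𝒬}`, `C` pairs meeting `S` with `s(s₀,v) ∈ C` — the
  interface of `upsetExchange`), `upsetExchange_joint_conn_notConn` (`E = {v ↔ s₀, v ↔ z₁, a ↮ z₂}`),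
  `upsetExchange_joint_notConn` (`E = {v ↔ s₀, a ↮ z}` = the validated row UEJ), and the block form (`v ↔ b`
  replaced by `s₀ ↔ b` on the right).

Use (law-level certificates, memo §1): these are the rows `UEJ[W; a ≤ v; S; z]` of the exchange-cone certificate
finder — conditioned minimality rows `H[a ≤ v | v ~ [S], v ~ z₁, a ≁ z₂]` that survive gluing `S` although the
premise is read before gluing.
-/

noncomputable section

namespace Summit.CriticalPhenomena.PercolationContinuityZ3.Theorems

open MeasureTheory Set Filter Topology
open Literature.Probability.LatticeModels
open Literature.Probability.Percolation Literature.Probability.Percolation.KNPreFKG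

open Classical


namespace UpsetExchange

variable {n : ℕ}

/-- **Anchored joint up-set exchange.**  `S` a block (any internal weights), `v` the anchor, `a` the relay, `E` any
event such that `E ∩ {every non-loop pair inside S open}` is increasing in the open edge cluster of `v` and
decreasing in that of `a`.  If `μ_w(a ↔ b) ≤ μ_w(v ↔ b)` (ranking in the UNGLUED graph) then
`μ_{glue_S w}(a ↔ b, E) ≤ μ_{glue_S w}(v ↔ b, E)`.
Proof: sprinkle the internal pairs of `S` (weights `(1−ε)w + ε`), apply `JointLemma3.lemma3_joint_event` with the
error `d(ε)·μ(Q ∩ D)/μ(D)`, `D = {v ↮ a}`; conditioning on "internal pairs open" is gluing, and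
`μ_{w_ε}(D, internal open) = μ_{w_ε}(internal open)·μ_{glue}(D) ≤ μ_{w_ε}(internal open)·μ_{w_ε}(D)` since `D` is
decreasing; divide and let `ε → 0`.
[cite: KozmaNitzan2024, Lemma 5 and Lemma 3 (pp. 6–7, 13); VandenbergHaggstromKahn2005, Thm. 1.5 (p. 7)] -/
theorem upsetExchange_joint (w : Sym2 (Fin n) → unitInterval) (S : Finset (Fin n)) (a b v : Fin n)
    (E : Set (BondConfig (Fin n)))
    (hE : ∀ ω ω' : BondConfig (Fin n), ω ∈ E →
      (∀ e : Sym2 (Fin n), (∀ x ∈ e, x ∈ S) → ¬ e.IsDiag → e ∈ ω) →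
      openEdgeCluster ω v ⊆ openEdgeCluster ω' v →
      openEdgeCluster ω' a ⊆ openEdgeCluster ω a →
      ω' ∈ E ∧ ∀ e : Sym2 (Fin n), (∀ x ∈ e, x ∈ S) → ¬ e.IsDiag → e ∈ ω')
    (hyp : (prodBernoulli w).real (openConn a b) ≤ (prodBernoulli w).real (openConn v b)) :
    (prodBernoulli (fun e : Sym2 (Fin n) => if (∀ x ∈ e, x ∈ S) ∧ ¬ e.IsDiag then 1 else w e)).real
        (openConn a b ∩ E) ≤
      (prodBernoulli (fun e : Sym2 (Fin n) => if (∀ x ∈ e, x ∈ S) ∧ ¬ e.IsDiag then 1 else w e)).real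
        (openConn v b ∩ E) := by
  classical
  set g : Sym2 (Fin n) → unitInterval := fun e => if (∀ x ∈ e, x ∈ S) ∧ ¬ e.IsDiag then 1 else w e with hg
  set D : Finset (Sym2 (Fin n)) := Finset.univ.filter (fun e => (∀ x ∈ e, x ∈ S) ∧ ¬ e.IsDiag) with hDdef
  have hD : ∀ e, e ∈ D ↔ (∀ x ∈ e, x ∈ S) ∧ ¬ e.IsDiag := fun e => by simp [hDdef]
  set ED : Set (BondConfig (Fin n)) := {ω | (↑D : Set (Sym2 (Fin n))) ⊆ ω} with hEDdef
  set Q : Set (BondConfig (Fin n)) := E ∩ ED with hQdef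
  set Dva : Set (BondConfig (Fin n)) := {ω | ¬ (openGraph ω).Reachable v a} with hDva
  -- `Q = E ∩ {D open}` is increasing in `C_v` and decreasing in `C_a`
  have hQmono : ∀ ω ω', ω ∈ Q → openEdgeCluster ω v ⊆ openEdgeCluster ω' v →
      openEdgeCluster ω' a ⊆ openEdgeCluster ω a → ω' ∈ Q := by
    intro ω ω' hω hsub hsub'
    have hF : ∀ e : Sym2 (Fin n), (∀ x ∈ e, x ∈ S) → ¬ e.IsDiag → e ∈ ω :=
      fun e heS hed => hω.2 (Finset.mem_coe.2 ((hD e).2 ⟨heS, hed⟩))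
    obtain ⟨hE', hF'⟩ := hE ω ω' hω.1 hF hsub hsub'
    refine ⟨hE', fun e he => ?_⟩
    have he' := (hD e).1 (Finset.mem_coe.1 he)
    exact hF' e he'.1 he'.2
  -- the sprinkled weights
  set u : unitInterval → Sym2 (Fin n) → unitInterval :=
    fun ε e => if e ∈ D then Set.Icc.convexComb (w e) 1 ε else w e with hu
  have hwu : ∀ ε, w ≤ u ε := by
    intro ε e
    by_cases he : e ∈ D
    · simp only [hu, he, if_true]
      exact Set.Icc.le_convexComb unitInterval.le_one' ε
    · simp only [hu, he, if_false]
      exact le_rfl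
  have hug : ∀ ε, u ε ≤ g := by
    intro ε e
    by_cases he : e ∈ D
    · have hge : g e = 1 := by simp only [hg, if_pos ((hD e).1 he)]
      rw [hge]
      exact unitInterval.le_one'
    · have he' : ¬ ((∀ x ∈ e, x ∈ S) ∧ ¬ e.IsDiag) := fun h => he ((hD e).2 h)
      have hge : g e = w e := by simp only [hg, if_neg he']
      simp only [hu, he, if_false, hge]
      exact le_rfl
  have hu0 : u 0 = w := by
    funext e
    by_cases he : e ∈ D
    · simp only [hu, he, if_true, Set.Icc.convexComb_zero]
    · simp only [hu, he, if_false]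
  have hucont : Continuous u := by
    refine continuous_pi fun e => ?_
    by_cases he : e ∈ D
    · simp only [hu, he, if_true]
      exact Set.Icc.continuous_convexComb (w e) 1
    · simp only [hu, he, if_false]
      exact continuous_const
  have hpin : ∀ ε, (fun e => if e ∈ D then (1 : unitInterval) else u ε e) = g := by
    intro ε
    funext e
    by_cases he : e ∈ D
    · simp only [hg, he, if_true, if_pos ((hD e).1 he)]
    · have he' : ¬ ((∀ x ∈ e, x ∈ S) ∧ ¬ e.IsDiag) := fun h => he ((hD e).2 h)
      simp only [hg, hu, he, if_false, if_neg he']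
  -- conditioning on `ED` is gluing
  have hcond : ∀ ε (X : Set (BondConfig (Fin n))),
      (prodBernoulli (u ε)).real (X ∩ ED) = (prodBernoulli (u ε)).real ED * (prodBernoulli g).real X := by
    intro ε X
    rw [hEDdef, gluingLemma5_real_inter_allOpen (u ε) D MeasurableSet.of_discrete, hpin ε]
  have hcondQ : ∀ ε (X : Set (BondConfig (Fin n))),
      (prodBernoulli (u ε)).real (X ∩ Q) = (prodBernoulli (u ε)).real ED * (prodBernoulli g).real (X ∩ E) := by
    intro ε X
    rw [hQdef, ← inter_assoc, hcond ε (X ∩ E)]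
  have hpos : ∀ ε : unitInterval, 0 < (ε : ℝ) → 0 < (prodBernoulli (u ε)).real ED := by
    intro ε hε
    rw [hEDdef, prodBernoulli_real_subset (u ε) D]
    refine Finset.prod_pos fun e he => ?_
    simp only [hu, he, if_true, Set.Icc.coe_convexComb, Set.Icc.coe_one, mul_one]
    exact add_pos_of_nonneg_of_pos
      (mul_nonneg (unitInterval.one_minus_nonneg ε) (unitInterval.nonneg (w e))) hε
  -- the error quotient of the joint Lemma 3 is at most `μ_{u ε}(ED)`
  have hratio : ∀ ε, (prodBernoulli (u ε)).real (Dva ∩ Q) / (prodBernoulli (u ε)).real Dva ≤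
      (prodBernoulli (u ε)).real ED := by
    intro ε
    have h1 : (prodBernoulli (u ε)).real (Dva ∩ Q) ≤ (prodBernoulli (u ε)).real (Dva ∩ ED) :=
      measureReal_mono (inter_subset_inter_right _ inter_subset_right)
    have h2 : (prodBernoulli (u ε)).real (Dva ∩ ED) =
        (prodBernoulli (u ε)).real ED * (prodBernoulli g).real Dva := hcond ε Dva
    have h3 : (prodBernoulli g).real Dva ≤ (prodBernoulli (u ε)).real Dva := by
      have hc : Dva = (openConn v a : Set (BondConfig (Fin n)))ᶜ := by
        ext ω
        simp only [hDva, mem_compl_iff, mem_setOf_eq, openConn]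
      have hm : (prodBernoulli (u ε)).real (openConn v a) ≤ (prodBernoulli g).real (openConn v a) :=
        prodBernoulli_real_mono_of_isUpperSet (hug ε) (isUpperSet_openConn v a) MeasurableSet.of_discrete
      rw [hc, measureReal_compl (MeasurableSet.of_discrete), measureReal_compl (MeasurableSet.of_discrete),
        probReal_univ, probReal_univ]
      linarith
    by_cases h0 : (prodBernoulli (u ε)).real Dva = 0
    · rw [h0, div_zero]
      exact measureReal_nonneg
    · have hpos' : 0 < (prodBernoulli (u ε)).real Dva := lt_of_le_of_ne measureReal_nonneg (Ne.symm h0)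
      rw [div_le_iff₀ hpos']
      calc (prodBernoulli (u ε)).real (Dva ∩ Q)
          ≤ (prodBernoulli (u ε)).real ED * (prodBernoulli g).real Dva := h1.trans h2.le
        _ ≤ (prodBernoulli (u ε)).real ED * (prodBernoulli (u ε)).real Dva :=
            mul_le_mul_of_nonneg_left h3 measureReal_nonneg
  -- the step at fixed `ε > 0`
  have hstep : ∀ ε : unitInterval, 0 < (ε : ℝ) →
      (prodBernoulli g).real (openConn a b ∩ E) ≤ (prodBernoulli g).real (openConn v b ∩ E) +
        ((prodBernoulli (u ε)).real (openConn a b) - (prodBernoulli w).real (openConn a b)) := by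
    intro ε hε
    have hma : (prodBernoulli w).real (openConn a b) ≤ (prodBernoulli (u ε)).real (openConn a b) :=
      prodBernoulli_real_mono_of_isUpperSet (hwu ε) (isUpperSet_openConn a b) MeasurableSet.of_discrete
    have hmv : (prodBernoulli w).real (openConn v b) ≤ (prodBernoulli (u ε)).real (openConn v b) :=
      prodBernoulli_real_mono_of_isUpperSet (hwu ε) (isUpperSet_openConn v b) MeasurableSet.of_discrete
    set d : ℝ := (prodBernoulli (u ε)).real (openConn a b) - (prodBernoulli w).real (openConn a b) with hd
    have hd0 : 0 ≤ d := sub_nonneg.2 hma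
    have h3 := JointLemma3.lemma3_joint_event (u ε) a v b Q hd0 hQmono (by linarith)
    have h3' : (prodBernoulli (u ε)).real (openConn a b ∩ Q) ≤
        (prodBernoulli (u ε)).real (openConn v b ∩ Q) + d * (prodBernoulli (u ε)).real ED :=
      h3.trans (by nlinarith [mul_le_mul_of_nonneg_left (hratio ε) hd0])
    rw [hcondQ ε (openConn a b), hcondQ ε (openConn v b)] at h3'
    have h4 : (prodBernoulli (u ε)).real ED * (prodBernoulli g).real (openConn a b ∩ E) ≤
        (prodBernoulli (u ε)).real ED * ((prodBernoulli g).real (openConn v b ∩ E) + d) := by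
      nlinarith [h3']
    exact le_of_mul_le_mul_left h4 (hpos ε hε)
  -- `ε → 0`
  obtain ⟨ε, hεpos, hεlim⟩ := gluingLemma5_exists_seq_tendsto_zero
  have hF : Continuous fun t : unitInterval => (prodBernoulli (u t)).real (openConn a b) :=
    (stub_weightContinuity n (openConn a b)).comp hucont
  have hlim : Tendsto (fun k => (prodBernoulli g).real (openConn v b ∩ E) +
      ((prodBernoulli (u (ε k))).real (openConn a b) - (prodBernoulli w).real (openConn a b)))
      atTop (𝓝 ((prodBernoulli g).real (openConn v b ∩ E) +
        ((prodBernoulli (u 0)).real (openConn a b) - (prodBernoulli w).real (openConn a b)))) :=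
    tendsto_const_nhds.add (((hF.tendsto 0).comp hεlim).sub tendsto_const_nhds)
  rw [hu0, sub_self, add_zero] at hlim
  exact ge_of_tendsto' hlim fun k => hstep (ε k) (hεpos k)

/-- If every non-loop pair inside `S` is open and `v` is joined to a member `s₀ ∈ S`, then every non-loop pair inside
`S` lies in the open edge cluster of `v`. [folklore] -/
theorem internal_subset_openEdgeCluster (S : Finset (Fin n)) (v s₀ : Fin n) (hs₀ : s₀ ∈ S)
    (ω : BondConfig (Fin n)) (hvs : (openGraph ω).Reachable v s₀)
    (hF : ∀ e : Sym2 (Fin n), (∀ x ∈ e, x ∈ S) → ¬ e.IsDiag → e ∈ ω) :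
    ∀ e : Sym2 (Fin n), (∀ x ∈ e, x ∈ S) → ¬ e.IsDiag → e ∈ openEdgeCluster ω v := by
  have hvS : ∀ s ∈ S, (openGraph ω).Reachable v s := by
    intro s hs
    by_cases hss : s = s₀
    · rw [hss]; exact hvs
    · have he : s(s₀, s) ∈ ω := hF _ (fun x hx => by
        rcases Sym2.mem_iff.1 hx with rfl | rfl <;> assumption) (by
        rw [Sym2.mk_isDiag_iff]; exact fun h => hss h.symm)
      exact hvs.trans ((openGraph_adj ω s₀ s).2 ⟨he, fun h => hss h.symm⟩).reachable
  intro e heS hed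
  exact ⟨hF e heS hed, hed, fun x hx => hvS x (heS x hx)⟩

/-- **Anchored joint exchange, family form.**  For `s₀ ∈ S` and every family `𝒬` of pairs of edge sets increasing
in the first and decreasing in the second coordinate: if `μ_w(a ↔ b) ≤ μ_w(v ↔ b)` then
`μ_{glue_S w}(a ↔ b, v ↔ s₀, (C_v, C_a) ∈ 𝒬) ≤ μ_{glue_S w}(v ↔ b, v ↔ s₀, (C_v, C_a) ∈ 𝒬)`.
[cite: KozmaNitzan2024, Lemma 5 and Lemma 3 (pp. 6–7, 13); VandenbergHaggstromKahn2005, Thm. 1.5 (p. 7)] -/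
theorem upsetExchange_joint_family (w : Sym2 (Fin n) → unitInterval) (S : Finset (Fin n)) (a b v s₀ : Fin n)
    (hs₀ : s₀ ∈ S)
    {𝒬 : Set (Set (Sym2 (Fin n)) × (Set (Sym2 (Fin n)))ᵒᵈ)} (h𝒬 : IsUpperSet 𝒬)
    (hyp : (prodBernoulli w).real (openConn a b) ≤ (prodBernoulli w).real (openConn v b)) :
    (prodBernoulli (fun e : Sym2 (Fin n) => if (∀ x ∈ e, x ∈ S) ∧ ¬ e.IsDiag then 1 else w e)).real
        (openConn a b ∩ (openConn v s₀ ∩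
          {ω : BondConfig (Fin n) | (openEdgeCluster ω v, OrderDual.toDual (openEdgeCluster ω a)) ∈ 𝒬})) ≤
      (prodBernoulli (fun e : Sym2 (Fin n) => if (∀ x ∈ e, x ∈ S) ∧ ¬ e.IsDiag then 1 else w e)).real
        (openConn v b ∩ (openConn v s₀ ∩
          {ω : BondConfig (Fin n) | (openEdgeCluster ω v, OrderDual.toDual (openEdgeCluster ω a)) ∈ 𝒬})) := by
  refine upsetExchange_joint w S a b v _ ?_ hyp
  intro ω ω' hω hF hsub hsub'
  obtain ⟨hvs, hq⟩ := hω
  have hvs' : (openGraph ω).Reachable v s₀ := hvs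
  have hint := internal_subset_openEdgeCluster S v s₀ hs₀ ω hvs' hF
  refine ⟨⟨?_, ?_⟩, fun e heS hed => openEdgeCluster_subset ω' v (hsub (hint e heS hed))⟩
  · -- `v ↔ s₀` is increasing in `C_v`
    have h1 : openEdgeCluster ω v ∈ connFamily v s₀ := by
      have := congrArg (fun T : Set (BondConfig (Fin n)) => ω ∈ T) (openConn_eq_setOf_connFamily v s₀)
      exact (this ▸ (show ω ∈ (openConn v s₀ : Set (BondConfig (Fin n))) from hvs) : _)
    have h2 : openEdgeCluster ω' v ∈ connFamily v s₀ := isUpperSet_connFamily v s₀ hsub h1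
    have h3 : ω' ∈ {ω : BondConfig (Fin n) | openEdgeCluster ω v ∈ connFamily v s₀} := h2
    rw [← openConn_eq_setOf_connFamily] at h3
    exact h3
  · exact h𝒬 (show ((openEdgeCluster ω v, OrderDual.toDual (openEdgeCluster ω a)) :
        Set (Sym2 (Fin n)) × (Set (Sym2 (Fin n)))ᵒᵈ) ≤
          (openEdgeCluster ω' v, OrderDual.toDual (openEdgeCluster ω' a)) from
      ⟨hsub, OrderDual.toDual_le_toDual.2 hsub'⟩) hq

/-- **Anchored joint exchange on an open-pairs piece** (the interface of `upsetExchange`): `v ∉ S`, `C` a finite set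
of non-loop pairs meeting `S` with `s(s₀, v) ∈ C` for some `s₀ ∈ S`, `𝒬` increasing/decreasing as above.  If
`μ_w(a ↔ b) ≤ μ_w(v ↔ b)` then `μ_{glue_S w}(a ↔ b, C open, (C_v, C_a) ∈ 𝒬) ≤ μ_{glue_S w}(v ↔ b, C open, (C_v, C_a) ∈ 𝒬)`.
[cite: KozmaNitzan2024, Lemma 5 and Lemma 3 (pp. 6–7, 13); VandenbergHaggstromKahn2005, Thm. 1.5 (p. 7)] -/
theorem upsetExchange_joint_open (w : Sym2 (Fin n) → unitInterval) (S : Finset (Fin n)) (a b v s₀ : Fin n)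
    (hvS : v ∉ S) (hs₀ : s₀ ∈ S)
    (C : Finset (Sym2 (Fin n))) (hC : ∀ e ∈ C, ¬ e.IsDiag ∧ ∃ x ∈ e, x ∈ S) (hsv : s(s₀, v) ∈ C)
    {𝒬 : Set (Set (Sym2 (Fin n)) × (Set (Sym2 (Fin n)))ᵒᵈ)} (h𝒬 : IsUpperSet 𝒬)
    (hyp : (prodBernoulli w).real (openConn a b) ≤ (prodBernoulli w).real (openConn v b)) :
    (prodBernoulli (fun e : Sym2 (Fin n) => if (∀ x ∈ e, x ∈ S) ∧ ¬ e.IsDiag then 1 else w e)).real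
        (openConn a b ∩ ({ω | (↑C : Set (Sym2 (Fin n))) ⊆ ω} ∩
          {ω : BondConfig (Fin n) | (openEdgeCluster ω v, OrderDual.toDual (openEdgeCluster ω a)) ∈ 𝒬})) ≤
      (prodBernoulli (fun e : Sym2 (Fin n) => if (∀ x ∈ e, x ∈ S) ∧ ¬ e.IsDiag then 1 else w e)).real
        (openConn v b ∩ ({ω | (↑C : Set (Sym2 (Fin n))) ⊆ ω} ∩
          {ω : BondConfig (Fin n) | (openEdgeCluster ω v, OrderDual.toDual (openEdgeCluster ω a)) ∈ 𝒬})) := by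
  refine upsetExchange_joint w S a b v _ ?_ hyp
  intro ω ω' hω hF hsub hsub'
  obtain ⟨hCω, hq⟩ := hω
  have hvs₀ : v ≠ s₀ := fun h => hvS (h ▸ hs₀)
  have key := subset_openEdgeCluster_of_open S C v s₀ hs₀ hsv hvs₀ hC ω hF hCω
  refine ⟨⟨fun e he => openEdgeCluster_subset ω' v (hsub (key.2 he)), ?_⟩,
    fun e heS hed => openEdgeCluster_subset ω' v (hsub (key.1 e heS hed))⟩
  exact h𝒬 (show ((openEdgeCluster ω v, OrderDual.toDual (openEdgeCluster ω a)) :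
      Set (Sym2 (Fin n)) × (Set (Sym2 (Fin n)))ᵒᵈ) ≤
        (openEdgeCluster ω' v, OrderDual.toDual (openEdgeCluster ω' a)) from
    ⟨hsub, OrderDual.toDual_le_toDual.2 hsub'⟩) hq

/-- **Anchored conditioned-minimality row**: for `s₀ ∈ S` and any vertices `z₁, z₂`, if `μ_w(a ↔ b) ≤ μ_w(v ↔ b)` then
`μ_{glue_S w}(a ↔ b, v ↔ s₀, v ↔ z₁, a ↮ z₂) ≤ μ_{glue_S w}(v ↔ b, v ↔ s₀, v ↔ z₁, a ↮ z₂)`.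
[cite: KozmaNitzan2024, Lemma 5 and Lemma 3 (pp. 6–7, 13); VandenbergHaggstromKahn2005, Thm. 1.5 (p. 7)] -/
theorem upsetExchange_joint_conn_notConn (w : Sym2 (Fin n) → unitInterval) (S : Finset (Fin n))
    (a b v s₀ : Fin n) (hs₀ : s₀ ∈ S) (z₁ z₂ : Fin n)
    (hyp : (prodBernoulli w).real (openConn a b) ≤ (prodBernoulli w).real (openConn v b)) :
    (prodBernoulli (fun e : Sym2 (Fin n) => if (∀ x ∈ e, x ∈ S) ∧ ¬ e.IsDiag then 1 else w e)).real
        (openConn a b ∩ (openConn v s₀ ∩ (openConn v z₁ ∩ (openConn a z₂)ᶜ))) ≤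
      (prodBernoulli (fun e : Sym2 (Fin n) => if (∀ x ∈ e, x ∈ S) ∧ ¬ e.IsDiag then 1 else w e)).real
        (openConn v b ∩ (openConn v s₀ ∩ (openConn v z₁ ∩ (openConn a z₂)ᶜ))) := by
  have key := upsetExchange_joint_family w S a b v s₀ hs₀ (JointLemma3.isUpperSet_connNotConnFamily v z₁ a z₂) hyp
  rw [JointLemma3.updownEvent_connNotConnFamily] at key
  exact key

/-- **The row `UEJ` of the exchange-cone certificate finder** (prim-lf-7 batch 15): for `s₀ ∈ S` and any vertex `z`,
if `μ_w(a ↔ b) ≤ μ_w(v ↔ b)` then `μ_{glue_S w}(a ↔ b, v ↔ s₀, a ↮ z) ≤ μ_{glue_S w}(v ↔ b, v ↔ s₀, a ↮ z)`.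
[cite: KozmaNitzan2024, Lemma 5 and Lemma 3 (pp. 6–7, 13); VandenbergHaggstromKahn2005, Thm. 1.5 (p. 7)] -/
theorem upsetExchange_joint_notConn (w : Sym2 (Fin n) → unitInterval) (S : Finset (Fin n))
    (a b v s₀ : Fin n) (hs₀ : s₀ ∈ S) (z : Fin n)
    (hyp : (prodBernoulli w).real (openConn a b) ≤ (prodBernoulli w).real (openConn v b)) :
    (prodBernoulli (fun e : Sym2 (Fin n) => if (∀ x ∈ e, x ∈ S) ∧ ¬ e.IsDiag then 1 else w e)).real
        (openConn a b ∩ (openConn v s₀ ∩ (openConn a z)ᶜ)) ≤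
      (prodBernoulli (fun e : Sym2 (Fin n) => if (∀ x ∈ e, x ∈ S) ∧ ¬ e.IsDiag then 1 else w e)).real
        (openConn v b ∩ (openConn v s₀ ∩ (openConn a z)ᶜ)) := by
  have key := upsetExchange_joint_conn_notConn w S a b v s₀ hs₀ s₀ z hyp
  rw [← inter_assoc (openConn v s₀ : Set (BondConfig (Fin n))), inter_self] at key
  exact key

/-- **Block form** of `upsetExchange_joint_conn_notConn`: on `{v ↔ s₀}` the anchor is joined to the member
`s₀ ∈ S`, so the bound is by `μ_{glue_S w}(s₀ ↔ b, v ↔ s₀, v ↔ z₁, a ↮ z₂)`. [cite: KozmaNitzan2024, Lemma 5 (p. 13)] -/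
theorem upsetExchange_joint_conn_notConn_block (w : Sym2 (Fin n) → unitInterval) (S : Finset (Fin n))
    (a b v s₀ : Fin n) (hs₀ : s₀ ∈ S) (z₁ z₂ : Fin n)
    (hyp : (prodBernoulli w).real (openConn a b) ≤ (prodBernoulli w).real (openConn v b)) :
    (prodBernoulli (fun e : Sym2 (Fin n) => if (∀ x ∈ e, x ∈ S) ∧ ¬ e.IsDiag then 1 else w e)).real
        (openConn a b ∩ (openConn v s₀ ∩ (openConn v z₁ ∩ (openConn a z₂)ᶜ))) ≤
      (prodBernoulli (fun e : Sym2 (Fin n) => if (∀ x ∈ e, x ∈ S) ∧ ¬ e.IsDiag then 1 else w e)).real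
        (openConn s₀ b ∩ (openConn v s₀ ∩ (openConn v z₁ ∩ (openConn a z₂)ᶜ))) := by
  refine (upsetExchange_joint_conn_notConn w S a b v s₀ hs₀ z₁ z₂ hyp).trans (measureReal_mono ?_)
  rintro ω ⟨hvb, hvs, hrest⟩
  exact ⟨(show (openGraph ω).Reachable v s₀ from hvs).symm.trans hvb, hvs, hrest⟩

end UpsetExchange

end Summit.CriticalPhenomena.PercolationContinuityZ3.Theorems

end
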